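import Literature.Analysis.FluidPDE.TypeIAncientMild
import HarnessLib

/-!
# Route `SymmetryModuliCount`, crux `SymmetricLiouville` (stmt-NavierStokesRegularity-4053), line `blowdown-kills-pitch`:
# tools for the integration stub T6 of the symmetry-free Oseen bootstrap

Summits-side theorem file (kind = proof, no definitions): elementary tools used by
`SymmetryModuliCountSymmetricLiouvilleOseenBootstrapOf.lean` —

* `envelope_basic`: the far-field envelope `m(L) = sup{w(t,x) : t < 0, L√(−t) ≤ ‖x‖}` of a size function
  `0 ≤ w ≤ C` is an upper bound, is `≤ C`, `≥ 0`, antitone, and inherits uniform bounds;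
* one-dimensional changes of variables for `∫⁻` (dilation on symmetric intervals, reflection of the past onto the
  future, even weights, and `∫⁻_{[0,b]} m² = ofReal ∫₀ᵇ m²` for antitone `m ≥ 0`);
* joint measurability of the two explicit integrands of the bootstrap (kernel × temporal weight; the sheet
  integrand).

References: Koch–Nadirashvili–Seregin–Šverák, Acta Math. 203 (2009) = arXiv:0709.3599, §4.
-/

noncomputable section

set_option linter.dupNamespace false

open Set Function Filter MeasureTheory
open scoped Topology ENNReal
open Literature.Analysis.FluidPDE

namespace Summit.NavierStokesRegularity.NavierStokesRegularity.Theorems.SymmetryModuliCountSymmetricLiouville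

/-! ## The far-field envelope of a scale-invariant size function -/

/-- **The envelope is an upper bound, is bounded, nonnegative and antitone, and inherits uniform bounds.**
For `w : ℝ → EuclideanSpace ℝ (Fin 3) → ℝ` with `0 ≤ w ≤ C` on `t < 0` and
`m L = sup {w t x : t < 0, L√(−t) ≤ ‖x‖}`. [folklore] -/
theorem envelope_basic {w : ℝ → EuclideanSpace ℝ (Fin 3) → ℝ} {C : ℝ} (hw0 : ∀ t < 0, ∀ x, 0 ≤ w t x)
    (hwC : ∀ t < 0, ∀ x, w t x ≤ C) {m : ℝ → ℝ}
    (hm : ∀ L, m L = sSup ((fun p : ℝ × EuclideanSpace ℝ (Fin 3) => w p.1 p.2) '' {p | p.1 < 0 ∧ L * Real.sqrt (-p.1) ≤ ‖p.2‖})) :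
    (∀ L, ∀ t < 0, ∀ x, L * Real.sqrt (-t) ≤ ‖x‖ → w t x ≤ m L) ∧ (∀ L, m L ≤ C) ∧ (∀ L, 0 ≤ m L) ∧
      Antitone m ∧
      (∀ L B, (∀ t < 0, ∀ x, L * Real.sqrt (-t) ≤ ‖x‖ → w t x ≤ B) → m L ≤ B) := by
  -- the sets are nonempty and bounded above by `C`
  set S : ℝ → Set ℝ := fun L =>
    (fun p : ℝ × EuclideanSpace ℝ (Fin 3) => w p.1 p.2) '' {p | p.1 < 0 ∧ L * Real.sqrt (-p.1) ≤ ‖p.2‖} with hS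
  have hne : ∀ L, (S L).Nonempty := by
    intro L
    -- the point `(−1, v)` with `‖v‖ = max L 0`
    obtain ⟨v, hv⟩ : ∃ v : EuclideanSpace ℝ (Fin 3), ‖v‖ = max L 0 :=
      exists_norm_eq (EuclideanSpace ℝ (Fin 3)) (le_max_right L 0)
    refine ⟨w (-1) v, ⟨((-1 : ℝ), v), ⟨by norm_num, ?_⟩, rfl⟩⟩
    simp only [neg_neg, Real.sqrt_one, mul_one, hv]
    exact le_max_left L 0
  have hbdd : ∀ L, BddAbove (S L) := by
    intro L
    refine ⟨C, ?_⟩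
    rintro _ ⟨p, hp, rfl⟩
    exact hwC p.1 hp.1 p.2
  have hm' : ∀ L, m L = sSup (S L) := fun L => hm L
  have hub : ∀ L, ∀ t < 0, ∀ x, L * Real.sqrt (-t) ≤ ‖x‖ → w t x ≤ m L := by
    intro L t ht x hx
    rw [hm' L]
    exact le_csSup (hbdd L) ⟨(t, x), ⟨ht, hx⟩, rfl⟩
  have hle : ∀ L B, (∀ t < 0, ∀ x, L * Real.sqrt (-t) ≤ ‖x‖ → w t x ≤ B) → m L ≤ B := by
    intro L B hB
    rw [hm' L]
    refine csSup_le (hne L) ?_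
    rintro _ ⟨p, hp, rfl⟩
    exact hB p.1 hp.1 p.2 hp.2
  refine ⟨hub, fun L => hle L C fun t ht x _ => hwC t ht x, fun L => ?_, fun L₁ L₂ hL => ?_, hle⟩
  · obtain ⟨v, ⟨p, hp, rfl⟩⟩ := hne L
    exact (hw0 p.1 hp.1 p.2).trans (hub L p.1 hp.1 p.2 hp.2)
  · -- antitone: the set for `L₂` is contained in the set for `L₁`
    refine hle L₂ (m L₁) fun t ht x hx => hub L₁ t ht x ?_
    exact (mul_le_mul_of_nonneg_right hL (Real.sqrt_nonneg _)).trans hx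

/-! ## One-dimensional changes of variables for `∫⁻` -/

/-- Dilation change of variables on `ℝ` for the lower integral (no measurability needed):
`∫ G(c s) ds = c⁻¹ ∫ G(r) dr` for `c > 0`. [folklore] -/
theorem lintegral_comp_mul_left_pos (G : ℝ → ℝ≥0∞) {c : ℝ} (hc : 0 < c) :
    ∫⁻ s, G (c * s) = ENNReal.ofReal c⁻¹ * ∫⁻ r, G r := by
  -- adapted from Literature/Analysis/Complex/ExtremalLength.lean (`lintegral_comp_mul_left_of_pos`)
  have h1 : ∫⁻ s, G (c * s) = ∫⁻ r, G r ∂(Measure.map (fun s ↦ c * s) volume) := by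
    rw [show (fun s ↦ c * s) = ⇑(Homeomorph.mulLeft₀ c hc.ne').toMeasurableEquiv from rfl,
      lintegral_map_equiv]
    rfl
  rw [h1, Real.map_volume_mul_left hc.ne', lintegral_smul_measure, smul_eq_mul,
    abs_of_pos (inv_pos.2 hc)]

/-- Dilation change of variables on a symmetric interval: for `c > 0`,
`∫_{[-cb, cb]} G(r) dr = c ∫_{[-b, b]} G(c ρ) dρ`. [folklore] -/
theorem setLIntegral_Icc_comp_mul (G : ℝ → ℝ≥0∞) {c : ℝ} (hc : 0 < c) (b : ℝ) :
    ∫⁻ r in Icc (-(c * b)) (c * b), G r = ENNReal.ofReal c * ∫⁻ ρ in Icc (-b) b, G (c * ρ) := by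
  rw [← lintegral_indicator measurableSet_Icc, ← lintegral_indicator measurableSet_Icc]
  have hind : (fun ρ => (Icc (-b) b).indicator (fun ρ => G (c * ρ)) ρ) =
      fun ρ => (Icc (-(c * b)) (c * b)).indicator G (c * ρ) := by
    funext ρ
    by_cases hρ : ρ ∈ Icc (-b) b
    · rw [indicator_of_mem hρ, indicator_of_mem]
      exact ⟨by nlinarith [hρ.1], by nlinarith [hρ.2]⟩
    · rw [indicator_of_notMem hρ, indicator_of_notMem]
      intro h
      exact hρ ⟨by nlinarith [h.1], by nlinarith [h.2]⟩
  rw [hind, lintegral_comp_mul_left_pos _ hc, ← mul_assoc, ← ENNReal.ofReal_mul hc.le,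
    mul_inv_cancel₀ hc.ne', ENNReal.ofReal_one, one_mul]

/-- Reflection of the past onto the future: `∫_{τ < t} G(τ) dτ = ∫_{s > -t} G(-s) ds`. [folklore] -/
theorem setLIntegral_Iio_eq_Ioi_neg (G : ℝ → ℝ≥0∞) (t : ℝ) :
    ∫⁻ τ in Iio t, G τ = ∫⁻ s in Ioi (-t), G (-s) := by
  have h := (Measure.measurePreserving_neg (volume : Measure ℝ)).setLIntegral_comp_preimage_emb
    (MeasurableEquiv.neg ℝ).measurableEmbedding G (Iio t)
  have hpre : (Neg.neg : ℝ → ℝ) ⁻¹' Iio t = Ioi (-t) := by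
    ext s
    simp only [mem_preimage, mem_Iio, mem_Ioi]
    constructor <;> intro h <;> linarith
  rw [← h, hpre]

/-- An even weight on a symmetric interval: `∫_{[-b,b]} g(|ρ|) dρ ≤ 2 ∫_{[0,b]} g(ρ) dρ`. [folklore] -/
theorem setLIntegral_Icc_abs_le (g : ℝ → ℝ≥0∞) (b : ℝ) :
    ∫⁻ ρ in Icc (-b) b, g |ρ| ≤ 2 * ∫⁻ ρ in Icc 0 b, g ρ := by
  have hsub : Icc (-b) b ⊆ Icc (-b) 0 ∪ Icc 0 b := fun ρ hρ => by
    rcases le_total ρ 0 with h | h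
    · exact Or.inl ⟨hρ.1, h⟩
    · exact Or.inr ⟨h, hρ.2⟩
  have hpos : ∫⁻ ρ in Icc 0 b, g |ρ| = ∫⁻ ρ in Icc 0 b, g ρ :=
    setLIntegral_congr_fun measurableSet_Icc fun ρ hρ => by rw [abs_of_nonneg hρ.1]
  have hneg : ∫⁻ ρ in Icc (-b) 0, g |ρ| = ∫⁻ ρ in Icc 0 b, g ρ := by
    have h := (Measure.measurePreserving_neg (volume : Measure ℝ)).setLIntegral_comp_preimage_emb
      (MeasurableEquiv.neg ℝ).measurableEmbedding (fun ρ => g |ρ|) (Icc (-b) 0)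
    have hpre : (Neg.neg : ℝ → ℝ) ⁻¹' Icc (-b) 0 = Icc 0 b := by
      ext s
      simp only [mem_preimage, mem_Icc]
      constructor <;> intro h <;> constructor <;> linarith [h.1, h.2]
    rw [hpre] at h
    rw [← h, ← hpos]
    exact setLIntegral_congr_fun measurableSet_Icc fun ρ _ => by rw [abs_neg]
  calc ∫⁻ ρ in Icc (-b) b, g |ρ| ≤ ∫⁻ ρ in Icc (-b) 0 ∪ Icc 0 b, g |ρ| := lintegral_mono_set hsub
    _ ≤ (∫⁻ ρ in Icc (-b) 0, g |ρ|) + ∫⁻ ρ in Icc 0 b, g |ρ| := lintegral_union_le _ _ _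
    _ = 2 * ∫⁻ ρ in Icc 0 b, g ρ := by rw [hneg, hpos, two_mul]

/-- For an antitone nonnegative `m`, `∫⁻_{[0,b]} m² = ofReal (∫_0^b m²)` (`b ≥ 0`). [folklore] -/
theorem setLIntegral_Icc_sq_eq_ofReal {m : ℝ → ℝ} (hanti : Antitone m) (hm0 : ∀ L, 0 ≤ m L) {b : ℝ}
    (hb : 0 ≤ b) :
    ∫⁻ ρ in Icc 0 b, ENNReal.ofReal (m ρ ^ 2) = ENNReal.ofReal (∫ s in (0:ℝ)..b, m s ^ 2) := by
  have hanti2 : Antitone fun s => m s ^ 2 := fun a c hac =>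
    pow_le_pow_left₀ (hm0 c) (hanti hac) 2
  have hint : IntegrableOn (fun s => m s ^ 2) (Icc 0 b) :=
    (hanti2.antitoneOn _).integrableOn_isCompact isCompact_Icc
  rw [intervalIntegral.integral_of_le hb, ← integral_Icc_eq_integral_Ioc,
    ofReal_integral_eq_lintegral_ofReal hint (Eventually.of_forall fun s => sq_nonneg _)]

/-! ## Measurability of the explicit integrands -/

/-- The kernel majorant against the temporal weight is jointly measurable in `(τ, y)`. [folklore] -/
theorem measurable_kernel_timeWeight : ∀ (t : ℝ) (x : EuclideanSpace ℝ (Fin 3)), Measurable fun p : ℝ × EuclideanSpace ℝ (Fin 3) => ENNReal.ofReal ((t - p.1 + ‖x - p.2‖ ^ 2)⁻¹ ^ 2 * (-p.1)⁻¹) := by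
  intro t x
  refine Measurable.ennreal_ofReal ?_
  refine Measurable.mul ?_ (measurable_fst.neg.inv)
  exact ((measurable_const.sub measurable_fst).add
    ((measurable_const.sub measurable_snd).norm.pow_const 2)).inv.pow_const 2

/-- The sheet integrand `(τ, ρ) ↦ m(|ρ|)² · (√(−τ))⁻¹ (t − τ + (X − ρ√(−τ))²)⁻¹` is jointly measurable for a
measurable envelope `m`. [folklore] -/
theorem measurable_sheet_integrand {m : ℝ → ℝ} (hm : Measurable m) (t X : ℝ) :
    Measurable fun p : ℝ × ℝ =>
      ENNReal.ofReal (m |p.2| ^ 2) *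
        ENNReal.ofReal ((Real.sqrt (-p.1))⁻¹ * (t - p.1 + (X - p.2 * Real.sqrt (-p.1)) ^ 2)⁻¹) := by
  have hs : Measurable fun p : ℝ × ℝ => Real.sqrt (-p.1) :=
    Real.continuous_sqrt.measurable.comp measurable_fst.neg
  have hA : Measurable fun p : ℝ × ℝ => ENNReal.ofReal (m |p.2| ^ 2) :=
    ((hm.comp measurable_snd.abs).pow_const 2).ennreal_ofReal
  have hB : Measurable fun p : ℝ × ℝ =>
      ENNReal.ofReal ((Real.sqrt (-p.1))⁻¹ * (t - p.1 + (X - p.2 * Real.sqrt (-p.1)) ^ 2)⁻¹) := by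
    refine Measurable.ennreal_ofReal (hs.inv.mul ?_)
    exact ((measurable_const.sub measurable_fst).add
      ((measurable_const.sub (measurable_snd.mul hs)).pow_const 2)).inv
  exact hA.mul hB

end Summit.NavierStokesRegularity.NavierStokesRegularity.Theorems.SymmetryModuliCountSymmetricLiouville

end
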